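import Summits.CriticalPhenomena.PercolationContinuityZ3.Theorems.FK.InfiniteVolumeDLRJoinGraph
import Summits.CriticalPhenomena.PercolationContinuityZ3.Theorems.FK.InfiniteVolumeDLRKernelOneEdge
import Summits.CriticalPhenomena.PercolationContinuityZ3.Theorems.FK.InfiniteVolumeDLRRegionTransport
import HarnessLib

/-!
# FK-continuity transplant, FO-10 (infinite-volume structure): one-class boundary wirings ARE lattice boundary
# conditions — the shell `Λ_{N+1} ∖ Λ_N` of `ℤ^d` (`d ≥ 2`) realises every wired class `B ⊆ ∂Λ_N`, and the
# specification kernel `φ^ξ_{Λ,p,q}` with such a `ξ` is the `B`-wired finite-volume measure `φ^B_{Λ,p,q}`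

Registered R108 (cell INBOX l.7499, 2026-08-25); registry row FO-10b-g420; label DLW-A (coordinator fk-4 g227).
Cell `fk-continuity` (bschramm), FO-10b lineage; support file for the FK-continuity transplant
(`--supports stmt-CriticalPhenomena-4575`); builds on p205010 (kernel theorem, internal audit signed; external
expert review pending). CONDITIONAL cell (FH AND TP_FK open at the same `p` for `q > 1`; K1); the transplant is a
typed reduction, not a proof of FK continuity — this file is UNCONDITIONAL finite-volume structure for general `d`
(`d ≥ 2` where stated), `0 ≤ p ≤ 1` and every `q > 0`; no defs, no named facts, no sorries, standard axioms; NOT a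
binder discharge, NOT `_r4`; `_r3` « 2 / 0 ☑ » unchanged, n_open = 2.

## What this file proves (Grimmett 2006, §4.2 (4.11)–(4.12) and the paragraph after (4.12), PDF pp. 71–72)

The tree holds two finite-volume random-cluster vocabularies on `ℤ^d`: the Literature's
`rcMeasure (finsetGraph (zdGraph d) Λ) p q B` — the measure of the finite graph `(Λ, E_Λ)` with ONE wired class
`B ⊆ ↥Λ` (the box laws `rcBoxLaw`, FO-10a's `BoundaryWiring*.lean`) — and the specification kernel
`rcCondLaw p q Λ ξ = φ^ξ_{Λ,p,q}` of `InfiniteVolumeDLRDefs.lean` — the pattern on `E_Λ` random, the configuration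
`ξ` of `ℤ^d` frozen off `E_Λ`, clusters counted in `ℤ^d` (the class `R_{p,q}`, Thm. (4.31): `InfiniteVolumeDLR*.lean`).
Grimmett passes between them by the remark after (4.12): `ξ` acts on `φ^ξ_{Λ,p,q}` only through the `ξ`-open paths
off `E_Λ` joining vertices of `∂Λ`. For the boundary conditions expressible in the first vocabulary (one wired class):

* §1 `reachable_corner_of_shell` — the shell `Λ_{N+1} ∖ Λ_N = {‖x‖_∞ = N + 1}`, `d ≥ 2`, is connected (raise the
  coordinates one at a time up to the corner `(N+1, …, N+1)`); **`exists_lattice_wiring`** — for `d ≥ 2` and every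
  `B ⊆ ∂Λ_N` there is a LATTICE configuration `ξ ⊆ E_{Λ_{N+1}} ∖ E_{Λ_N}` (the shell edges and one edge from each
  vertex of `B` into the shell) whose open paths join two vertices of `Λ_N` iff they are equal or both lie in `B`;
* §2 for ANY finite region `Λ`, wired class `B ⊆ ↥Λ` and configuration `ξ` off `E_Λ` with that property:
  `comap_fromRel_reachable_eq_wired` — the boundary-condition graph `R_ξ` of `InfiniteVolumeDLRJoinGraph.lean` IS
  `wired B`; `rcCondWeight_eq_of_wiring`, `rcCondPartition_eq_of_wiring` — kernel weight and normalisation are the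
  `B`-wired weight and partition function of `(Λ, E_Λ)` (as pattern sums); **`rcCondLaw_real_eq_of_wiring`** (and `rcCondLaw_apply_eq_of_wiring` on `ℝ≥0∞`,
  `rcCondLaw_real_eq_of_wiring_of_forall`) — for `0 ≤ p ≤ 1`, `q > 0`:
  `φ^ξ_{Λ,p,q}(A) = φ^B_{Λ,p,q}(liftEdges Λ ⁻¹' A)` for every measurable event `A` insensitive to the edges of `ξ` —
  over KCM-A `rcCondWeight_eq_pow_card_comap` and KCM-C `rcMeasure_finsetGraph_real_preimage_liftEdges_eq` (cited by
  name, nothing restated); the inside-law form and `Z^ξ_Λ = Z^B_{(Λ,E_Λ)}` are in the companion file.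

Companion `InfiniteVolumeDLRWiringLimit.lean`: hence local limits of one-class-wired box measures are local limits of
`φ^{ξ_k}_{Λ_{N_k},p,q}` with lattice `ξ_k`, and Grimmett's Theorem (4.31) (`InfiniteVolumeDLRLocalLimit.lean`) applies to
the limit points of FO-10a's `BoundaryWiringLimitPoints.lean`.

## References

* G. Grimmett, *The Random-Cluster Model*, Springer 2006 (`book:grimmett2006-random-cluster-model`): §1.2 eqs.
  (1.1)–(1.3); §4.2 (4.11)–(4.13) with the paragraph after (4.12) and the extremal configurations `0`, `1`
  [PDF pp. 71–72]; Lemma (4.13); Lemma (4.14)(b); Def. (4.26). [Grimmett2006]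
-/

noncomputable section

open MeasureTheory Set Filter
open scoped Topology ENNReal

namespace Summit.CriticalPhenomena.PercolationContinuityZ3.Theorems.FK

open Literature.Probability.Percolation Literature.Probability.LatticeModels

variable {d : ℕ}

/-! ### §1 Geometry: the shell `Λ_{N+1} ∖ Λ_N` of `ℤ^d` (`d ≥ 2`) is connected and realises every one-class wiring -/

section Shell

variable {N : ℕ} {ζ : BondConfig (Site d)}

/-- A point of `ℤ^d` with a coordinate of modulus `N + 1` lies off the box `Λ_N`. [folklore] -/
theorem not_mem_box_of_apply_eq {x : Site d} {w : Fin d} (hw : x w = (N : ℤ) + 1 ∨ x w = -((N : ℤ) + 1)) :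
    x ∉ box d N := by
  intro h
  have := (mem_box.1 h) w
  omega

/-- A point of the shell `Λ_{N+1} ∖ Λ_N` has a coordinate of modulus `N + 1`. [folklore] -/
theorem exists_apply_eq_of_mem_box_succ {x : Site d} (hx : x ∈ box d (N + 1)) (hx' : x ∉ box d N) :
    ∃ w : Fin d, x w = (N : ℤ) + 1 ∨ x w = -((N : ℤ) + 1) := by
  rw [mem_box] at hx hx'
  push Not at hx'
  obtain ⟨w, hw⟩ := hx'
  refine ⟨w, ?_⟩
  have h1 := hx w
  push_cast at h1
  omega

/-- A lattice neighbour of a point of `Λ_N` lies in `Λ_{N+1}`. [folklore] -/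
theorem mem_box_succ_of_adj {x y : Site d} (hx : x ∈ box d N) (hxy : (zdGraph d).Adj x y) : y ∈ box d (N + 1) := by
  rw [mem_box] at hx ⊢
  obtain ⟨i, h⟩ := (zdGraph_adj_iff x y).1 hxy
  intro j
  have h1 := hx j
  push_cast
  by_cases hji : j = i
  · subst hji
    rcases h with rfl | rfl
    · simp only [Pi.add_apply, Pi.single_eq_same]; omega
    · simp only [Pi.add_apply, Pi.single_eq_same] at h1; omega
  · rcases h with rfl | rfl
    · simp only [Pi.add_apply, Pi.single_eq_of_ne hji, add_zero]; omega
    · simp only [Pi.add_apply, Pi.single_eq_of_ne hji, add_zero] at h1; omega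

/-- **One coordinate may be raised inside the shell**: if every lattice edge with both end points in `Λ_{N+1} ∖ Λ_N` is
`ζ`-open, `x ∈ Λ_{N+1}` has a coordinate `w` of modulus `N + 1` and `i ≠ w`, then `x` is `ζ`-joined to `x + k eᵢ` whenever
`x i + k ≤ N + 1`. [folklore] -/
theorem reachable_add_single_of_shell
    (hζ : ∀ x y : Site d, x ∈ box d (N + 1) → x ∉ box d N → y ∈ box d (N + 1) → y ∉ box d N →
      (zdGraph d).Adj x y → s(x, y) ∈ ζ)
    {x : Site d} (hx : x ∈ box d (N + 1)) {w : Fin d} (hw : x w = (N : ℤ) + 1 ∨ x w = -((N : ℤ) + 1))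
    {i : Fin d} (hi : i ≠ w) :
    ∀ k : ℕ, x i + k ≤ (N : ℤ) + 1 → (openGraph ζ).Reachable x (x + Pi.single i (k : ℤ))
  | 0, _ => by simp
  | k + 1, hk => by
    have hk' : x i + (k : ℤ) ≤ (N : ℤ) + 1 := by push_cast at hk; omega
    have hxb := mem_box.1 hx
    -- the two consecutive points of the path lie in the shell
    have hmem : ∀ m : ℕ, x i + (m : ℤ) ≤ (N : ℤ) + 1 → x + Pi.single i (m : ℤ) ∈ box d (N + 1) := by
      intro m hm
      rw [mem_box]
      intro j
      push_cast
      by_cases hji : j = i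
      · subst hji
        have := hxb j
        simp only [Pi.add_apply, Pi.single_eq_same]
        push_cast at this
        omega
      · have := hxb j
        simp only [Pi.add_apply, Pi.single_eq_of_ne hji, add_zero]
        push_cast at this
        omega
    have hw' : ∀ m : ℤ, (x + Pi.single i m : Site d) w = (N : ℤ) + 1 ∨ (x + Pi.single i m : Site d) w = -((N : ℤ) + 1) := by
      intro m
      simpa only [Pi.add_apply, Pi.single_eq_of_ne hi.symm, add_zero] using hw
    have hstep : x + Pi.single i ((k + 1 : ℕ) : ℤ) = (x + Pi.single i (k : ℤ)) + Pi.single i 1 := by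
      push_cast
      rw [add_assoc, ← Pi.single_add]
    have hadj : (zdGraph d).Adj (x + Pi.single i (k : ℤ)) (x + Pi.single i ((k + 1 : ℕ) : ℤ)) :=
      (zdGraph_adj_iff _ _).2 ⟨i, Or.inl hstep⟩
    have hopen : (openGraph ζ).Adj (x + Pi.single i (k : ℤ)) (x + Pi.single i ((k + 1 : ℕ) : ℤ)) :=
      (openGraph_adj _ _ _).2 ⟨hζ _ _ (hmem k hk') (not_mem_box_of_apply_eq (hw' k)) (hmem (k + 1) hk)
        (not_mem_box_of_apply_eq (hw' _)) hadj, hadj.ne⟩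
    exact (reachable_add_single_of_shell hζ hx hw hi k hk').trans hopen.reachable

/-- Coordinates of a sum of scaled unit vectors. [folklore] -/
theorem finset_sum_single_apply (s : Finset (Fin d)) (f : Fin d → ℤ) (k : Fin d) :
    (∑ j ∈ s, (Pi.single j (f j) : Site d)) k = if k ∈ s then f k else 0 := by
  rw [Finset.sum_apply]
  simp only [Pi.single_apply]
  rw [Finset.sum_ite_eq]

/-- Raising, one at a time, every coordinate `j ∈ s` of a point of `Λ_{N+1}` whose coordinate `i ∉ s` already equals
`N + 1`, inside the shell. [folklore] -/
theorem reachable_add_sum_single_of_shell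
    (hζ : ∀ x y : Site d, x ∈ box d (N + 1) → x ∉ box d N → y ∈ box d (N + 1) → y ∉ box d N →
      (zdGraph d).Adj x y → s(x, y) ∈ ζ)
    {i : Fin d} (s : Finset (Fin d)) :
    ∀ y : Site d, y ∈ box d (N + 1) → y i = (N : ℤ) + 1 → i ∉ s →
      (openGraph ζ).Reachable y (y + ∑ j ∈ s, Pi.single j ((N : ℤ) + 1 - y j)) := by
  classical
  induction s using Finset.induction_on with
  | empty => intro y _ _ _; simp
  | insert a s ha ih =>
    intro y hy hyi hnot
    rw [Finset.mem_insert, not_or] at hnot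
    obtain ⟨hia, his⟩ := hnot
    set z : Site d := y + ∑ j ∈ s, Pi.single j ((N : ℤ) + 1 - y j) with hz
    have hyb := mem_box.1 hy
    have hzj : ∀ j, z j = if j ∈ s then (N : ℤ) + 1 else y j := by
      intro j
      rw [hz, Pi.add_apply, finset_sum_single_apply]
      split_ifs <;> ring
    have hzb : z ∈ box d (N + 1) := by
      rw [mem_box]
      intro j
      rw [hzj j]
      have := hyb j
      push_cast at this ⊢
      split_ifs <;> omega
    have hzi : z i = (N : ℤ) + 1 := by rw [hzj i, if_neg his, hyi]
    have hza : z a = y a := by rw [hzj a, if_neg ha]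
    -- raise the coordinate `a` of `z`
    have hka : (((N : ℤ) + 1 - y a).toNat : ℤ) = (N : ℤ) + 1 - y a := by
      have := hyb a
      push_cast at this
      exact Int.toNat_of_nonneg (by omega)
    have hreach := reachable_add_single_of_shell hζ hzb (w := i) (Or.inl hzi) (i := a) (Ne.symm hia)
      (((N : ℤ) + 1 - y a).toNat) (by rw [hka, hza]; omega)
    rw [hka] at hreach
    have heq : y + ∑ j ∈ insert a s, Pi.single j ((N : ℤ) + 1 - y j) = z + Pi.single a ((N : ℤ) + 1 - y a) := by
      rw [Finset.sum_insert ha, hz]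
      abel
    rw [heq]
    exact (ih y hy hyi his).trans hreach

/-- **The shell `Λ_{N+1} ∖ Λ_N` of `ℤ^d`, `d ≥ 2`, is connected**: if every lattice edge with both end points in the shell
is `ζ`-open, every point of the shell is `ζ`-joined to the corner `(N+1, …, N+1)`. [folklore] -/
theorem reachable_corner_of_shell (hd : 2 ≤ d)
    (hζ : ∀ x y : Site d, x ∈ box d (N + 1) → x ∉ box d N → y ∈ box d (N + 1) → y ∉ box d N →
      (zdGraph d).Adj x y → s(x, y) ∈ ζ)
    {x : Site d} (hx : x ∈ box d (N + 1)) (hx' : x ∉ box d N) :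
    (openGraph ζ).Reachable x (fun _ => (N : ℤ) + 1) := by
  classical
  obtain ⟨w, hw⟩ := exists_apply_eq_of_mem_box_succ hx hx'
  haveI : Nontrivial (Fin d) := Fin.nontrivial_iff_two_le.2 hd
  obtain ⟨i, hi⟩ := exists_ne w
  have hxb := mem_box.1 hx
  -- stage 1: raise the coordinate `i ≠ w` to `N + 1`
  have hk : (((N : ℤ) + 1 - x i).toNat : ℤ) = (N : ℤ) + 1 - x i := by
    have := hxb i
    push_cast at this
    exact Int.toNat_of_nonneg (by omega)
  have h1 := reachable_add_single_of_shell hζ hx hw hi (((N : ℤ) + 1 - x i).toNat) (by rw [hk]; omega)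
  rw [hk] at h1
  set x₁ : Site d := x + Pi.single i ((N : ℤ) + 1 - x i) with hx₁
  have hx₁i : x₁ i = (N : ℤ) + 1 := by simp [hx₁]
  have hx₁j : ∀ j, j ≠ i → x₁ j = x j := fun j hj => by simp [hx₁, Pi.single_eq_of_ne hj]
  have hx₁b : x₁ ∈ box d (N + 1) := by
    rw [mem_box]
    intro j
    by_cases hji : j = i
    · subst hji; rw [hx₁i]; push_cast; omega
    · rw [hx₁j j hji]; exact hxb j
  -- stage 2: raise every other coordinate, with `i` as the witness
  have h2 := reachable_add_sum_single_of_shell hζ (Finset.univ.erase i) x₁ hx₁b hx₁i (Finset.notMem_erase i _)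
  have heq : x₁ + ∑ j ∈ Finset.univ.erase i, Pi.single j ((N : ℤ) + 1 - x₁ j) = fun _ => (N : ℤ) + 1 := by
    funext k
    rw [Pi.add_apply, finset_sum_single_apply]
    by_cases hki : k = i
    · subst hki; rw [if_neg (Finset.notMem_erase k _), hx₁i, add_zero]
    · rw [if_pos (Finset.mem_erase.2 ⟨hki, Finset.mem_univ k⟩)]; ring
  rw [heq] at h2
  exact h1.trans h2


/-- **Every one-class boundary wiring of a box is realised by a lattice configuration outside the box** (`d ≥ 2`):
for a wired class `B ⊆ ∂Λ_N` there is a set `ξ` of lattice edges off `E_{Λ_N}`, inside `Λ_{N+1}` (the edges of the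
shell `Λ_{N+1} ∖ Λ_N` together with one edge from each vertex of `B` into the shell), whose open paths join two
vertices of `Λ_N` iff they are equal or both lie in `B` — Grimmett's external configurations `ξ` whose clusters meet
`∂Λ_N` in the single class `B`. [cite: Grimmett2006, §4.2 (4.11)–(4.12) (boundary conditions ξ), Lemma (4.14)(b)] -/
theorem exists_lattice_wiring (hd : 2 ≤ d) (N : ℕ) {B : Set ↥(box d N)}
    (hB : B ⊆ wiredBoundary (zdGraph d) (box d N)) :
    ∃ ξ : BondConfig (Site d), ξ ⊆ (zdGraph d).edgeSet ∧ Disjoint ξ ↑(edgesIn (zdGraph d) (box d N)) ∧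
      ξ ⊆ ↑(edgesIn (zdGraph d) (box d (N + 1))) ∧
      ∀ u v : ↥(box d N), (openGraph ξ).Reachable (u : Site d) v ↔ u = v ∨ (u ∈ B ∧ v ∈ B) := by
  classical
  set B' : Set (Site d) := Subtype.val '' B with hB'
  set ξ : BondConfig (Site d) := {e | e ∈ (zdGraph d).edgeSet ∧
    (∀ v ∈ e, (v ∈ box d (N + 1) ∧ v ∉ box d N) ∨ v ∈ B') ∧ ∃ v ∈ e, v ∉ box d N} with hξ
  -- the shell edges are in `ξ`
  have hζ : ∀ x y : Site d, x ∈ box d (N + 1) → x ∉ box d N → y ∈ box d (N + 1) → y ∉ box d N →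
      (zdGraph d).Adj x y → s(x, y) ∈ ξ := fun x y hx hx' hy hy' hxy =>
    ⟨(zdGraph d).mem_edgeSet.2 hxy, fun v hv => by
      rcases Sym2.mem_iff.1 hv with rfl | rfl
      · exact Or.inl ⟨hx, hx'⟩
      · exact Or.inl ⟨hy, hy'⟩, x, Sym2.mem_mk_left _ _, hx'⟩
  refine ⟨ξ, fun e he => he.1, ?_, ?_, fun u v => ⟨fun h => ?_, ?_⟩⟩
  · rw [Set.disjoint_left]
    rintro e ⟨-, -, v, hv, hvN⟩ heE
    exact hvN ((mem_edgesIn_iff.1 (Finset.mem_coe.1 heE)).2 v hv)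
  · intro e he
    rw [Finset.mem_coe, mem_edgesIn_iff]
    refine ⟨he.1, fun v hv => ?_⟩
    rcases he.2.1 v hv with h | ⟨b, -, rfl⟩
    · exact h.1
    · exact box_mono d (Nat.le_succ N) b.2
  · -- a vertex of `Λ_N` with a `ξ`-edge is a vertex of `B`
    have key : ∀ {a : ↥(box d N)} {b : Site d}, (openGraph ξ).Reachable (a : Site d) b → (a : Site d) ≠ b → a ∈ B := by
      intro a b hab hne
      obtain ⟨W⟩ := hab
      cases W with
      | nil => exact absurd rfl hne
      | cons hadj _ =>
        obtain ⟨⟨-, hall, -⟩, -⟩ := (openGraph_adj _ _ _).1 hadj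
        rcases hall a (Sym2.mem_mk_left _ _) with hS | ⟨b', hb', hb'a⟩
        · exact absurd a.2 hS.2
        · rwa [← Subtype.ext hb'a]
    by_cases huv : u = v
    · exact Or.inl huv
    · exact Or.inr ⟨key h fun h' => huv (Subtype.ext h'), key h.symm fun h' => huv (Subtype.ext h'.symm)⟩
  · -- every vertex of `B` is joined to the corner of the shell
    have conn : ∀ a : ↥(box d N), a ∈ B → (openGraph ξ).Reachable (a : Site d) (fun _ => (N : ℤ) + 1) := by
      intro a ha
      obtain ⟨-, y, hyN, hay⟩ := mem_innerBoundary_iff.1 ((mem_wiredBoundary_iff a).1 (hB ha))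
      have hy : y ∈ box d (N + 1) := mem_box_succ_of_adj a.2 hay
      have hedge : s((a : Site d), y) ∈ ξ :=
        ⟨(zdGraph d).mem_edgeSet.2 hay, fun v hv => by
          rcases Sym2.mem_iff.1 hv with rfl | rfl
          · exact Or.inr ⟨a, ha, rfl⟩
          · exact Or.inl ⟨hy, hyN⟩, y, Sym2.mem_mk_right _ _, hyN⟩
      exact ((openGraph_adj _ _ _).2 ⟨hedge, hay.ne⟩).reachable.trans (reachable_corner_of_shell hd hζ hy hyN)
    rintro (rfl | ⟨hu, hv⟩)
    · rfl
    · exact (conn u hu).trans (conn v hv).symm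

end Shell


/-! ### §2 The kernel with a boundary condition realising a one-class wiring IS the wired finite-volume measure -/

section Kernel

variable {p q : ℝ} {Λ : Finset (Site d)} {B : Set ↥Λ} {ξ : BondConfig (Site d)}

/-- **The boundary-condition graph of a configuration realising the wiring `B` is `wired B`**: if the `ξ`-open paths
(`ξ` off `E_Λ`) join two vertices of `Λ` iff they are equal or both in `B`, then the `ξ`-connection graph pulled back
to `↥Λ` (the boundary-condition graph `R_ξ` of `InfiniteVolumeDLRJoinGraph`) is the wiring graph of `B`.
[cite: Grimmett2006, §4.2 (4.11)–(4.12), Lemma (4.13)] -/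
theorem comap_fromRel_reachable_eq_wired (hξ : Disjoint ξ ↑(edgesIn (zdGraph d) Λ))
    (hR : ∀ u v : ↥Λ, (openGraph ξ).Reachable (u : Site d) v ↔ u = v ∨ (u ∈ B ∧ v ∈ B)) :
    (SimpleGraph.fromRel (openGraph (ξ \ ↑(edgesIn (zdGraph d) Λ))).Reachable).comap (Subtype.val : ↥Λ → Site d) =
      wired B := by
  rw [sdiff_eq_left.2 hξ]
  ext a b
  rw [SimpleGraph.comap_adj, fromRel_reachable_adj, wired_adj]
  constructor
  · rintro ⟨hne, h⟩
    have hne' : a ≠ b := fun h' => hne (congrArg Subtype.val h')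
    rcases (hR a b).1 h with h' | h'
    · exact absurd h' hne'
    · exact ⟨hne', h'⟩
  · rintro ⟨hne, ha, hb⟩
    exact ⟨fun h => hne (Subtype.ext h), (hR a b).2 (Or.inr ⟨ha, hb⟩)⟩

/-- **The kernel weight under a boundary condition realising the wiring `B` is the `B`-wired random-cluster weight**:
`w^ξ_Λ(η) = p^{|η|} (1-p)^{|E_Λ ∖ η|} q^{k_B(η)}` with `k_B(η)` the number of components of the open graph of `η` on `↥Λ`
glued with `wired B` (the weight of `InfiniteVolumeDLRRegionTransport.rcMeasure_finsetGraph_real_preimage_liftEdges_eq`).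
[cite: Grimmett2006, §4.2 (4.11)–(4.12), Lemma (4.13)] -/
theorem rcCondWeight_eq_of_wiring (p q : ℝ) (hξ : Disjoint ξ ↑(edgesIn (zdGraph d) Λ))
    (hR : ∀ u v : ↥Λ, (openGraph ξ).Reachable (u : Site d) v ↔ u = v ∨ (u ∈ B ∧ v ∈ B))
    {η : Finset (Sym2 (Site d))} (hη : η ⊆ edgesIn (zdGraph d) Λ) :
    rcCondWeight p q Λ ξ η = p ^ η.card * (1 - p) ^ (edgesIn (zdGraph d) Λ \ η).card *
      q ^ Nat.card ((openGraph (↑η : BondConfig (Site d))).comap (Subtype.val : ↥Λ → Site d) ⊔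
        wired B).ConnectedComponent := by
  rw [← comap_fromRel_reachable_eq_wired hξ hR]
  exact rcCondWeight_eq_pow_card_comap p q Λ ξ hη

/-- The normalisation `Z^ξ_Λ` under a boundary condition realising the wiring `B` is the `B`-wired partition function of
`(Λ, E_Λ)`, as a pattern sum. [cite: Grimmett2006, §4.2 (4.12)] -/
theorem rcCondPartition_eq_of_wiring (p q : ℝ) (hξ : Disjoint ξ ↑(edgesIn (zdGraph d) Λ))
    (hR : ∀ u v : ↥Λ, (openGraph ξ).Reachable (u : Site d) v ↔ u = v ∨ (u ∈ B ∧ v ∈ B)) :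
    rcCondPartition p q Λ ξ = ∑ η ∈ (edgesIn (zdGraph d) Λ).powerset,
      p ^ η.card * (1 - p) ^ (edgesIn (zdGraph d) Λ \ η).card *
        q ^ Nat.card ((openGraph (↑η : BondConfig (Site d))).comap (Subtype.val : ↥Λ → Site d) ⊔
          wired B).ConnectedComponent := by
  rw [rcCondPartition_eq]
  exact Finset.sum_congr rfl fun η hη => rcCondWeight_eq_of_wiring p q hξ hR (Finset.mem_powerset.1 hη)

/-- **A lattice boundary condition realising the one-class wiring `B` induces the `B`-wired measure** (Grimmett's
`φ^ξ_{Λ,p,q}` for an external configuration `ξ` whose clusters meet `Λ` in the single class `B` is the Literature's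
`φ^B_{(Λ,E_Λ),p,q}` read on `ℤ^d`), general transport form: for `0 ≤ p ≤ 1`, `q > 0`, a measurable event `A` and an
event `A'` such that `η ∪ ξ ∈ A ↔ η ∈ A'` for every inside pattern `η ⊆ E_Λ`,
`φ^ξ_{Λ,p,q}(A) = φ^B_{Λ,p,q}(liftEdges Λ ⁻¹' A')`. [cite: Grimmett2006, §4.2 (4.11)–(4.12), Lemma (4.13)] -/
theorem rcCondLaw_real_eq_of_wiring_of_forall (hp : p ∈ Set.Icc (0 : ℝ) 1) (hq : 0 < q)
    (hξ : Disjoint ξ ↑(edgesIn (zdGraph d) Λ))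
    (hR : ∀ u v : ↥Λ, (openGraph ξ).Reachable (u : Site d) v ↔ u = v ∨ (u ∈ B ∧ v ∈ B))
    {A A' : Set (BondConfig (Site d))} (hAm : MeasurableSet A)
    (hA : ∀ η : Finset (Sym2 (Site d)), η ⊆ edgesIn (zdGraph d) Λ → ((↑η : BondConfig (Site d)) ∪ ξ ∈ A ↔ ↑η ∈ A')) :
    (rcCondLaw p q Λ ξ).real A = (rcMeasure (finsetGraph (zdGraph d) Λ) p q B).real (liftEdges Λ ⁻¹' A') := by
  classical
  rw [rcCondLaw_real_eq_sum_mul_indicator hp hq Λ ξ hAm, rcMeasure_finsetGraph_real_preimage_liftEdges_eq hp hq Λ B A',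
    ← rcCondPartition_eq_of_wiring p q hξ hR, Finset.sum_div]
  refine Finset.sum_congr rfl fun η hη => ?_
  have hηE := Finset.mem_powerset.1 hη
  rw [sdiff_eq_left.2 hξ, rcCondProb_eq, rcCondWeight_eq_of_wiring p q hξ hR hηE, Set.indicator_apply]
  simp only [hA η hηE]
  split_ifs <;> simp

/-- **`φ^ξ_{Λ,p,q}(A) = φ^B_{Λ,p,q}(liftEdges Λ ⁻¹' A)` for every measurable event `A` insensitive to the edges of `ξ`**
(`ξ` a boundary condition realising the one-class wiring `B`; `0 ≤ p ≤ 1`, `q > 0`).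
[cite: Grimmett2006, §4.2 (4.11)–(4.12), Lemma (4.13)] -/
theorem rcCondLaw_real_eq_of_wiring (hp : p ∈ Set.Icc (0 : ℝ) 1) (hq : 0 < q)
    (hξ : Disjoint ξ ↑(edgesIn (zdGraph d) Λ))
    (hR : ∀ u v : ↥Λ, (openGraph ξ).Reachable (u : Site d) v ↔ u = v ∨ (u ∈ B ∧ v ∈ B))
    {A : Set (BondConfig (Site d))} (hAm : MeasurableSet A) (hA : ∀ ω : BondConfig (Site d), ω ∪ ξ ∈ A ↔ ω ∈ A) :
    (rcCondLaw p q Λ ξ).real A = (rcMeasure (finsetGraph (zdGraph d) Λ) p q B).real (liftEdges Λ ⁻¹' A) :=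
  rcCondLaw_real_eq_of_wiring_of_forall hp hq hξ hR hAm fun _ _ => hA _

/-- The same identity on `ℝ≥0∞`: `φ^ξ_{Λ,p,q}(A) = φ^B_{Λ,p,q}(liftEdges Λ ⁻¹' A)` for measurable `A` insensitive to `ξ`.
[cite: Grimmett2006, §4.2 (4.11)–(4.12), Lemma (4.13)] -/
theorem rcCondLaw_apply_eq_of_wiring (hp : p ∈ Set.Icc (0 : ℝ) 1) (hq : 0 < q)
    (hξ : Disjoint ξ ↑(edgesIn (zdGraph d) Λ))
    (hR : ∀ u v : ↥Λ, (openGraph ξ).Reachable (u : Site d) v ↔ u = v ∨ (u ∈ B ∧ v ∈ B))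
    {A : Set (BondConfig (Site d))} (hAm : MeasurableSet A) (hA : ∀ ω : BondConfig (Site d), ω ∪ ξ ∈ A ↔ ω ∈ A) :
    rcCondLaw p q Λ ξ A =
      ENNReal.ofReal ((rcMeasure (finsetGraph (zdGraph d) Λ) p q B).real (liftEdges Λ ⁻¹' A)) := by
  haveI := isProbabilityMeasure_rcCondLaw hp hq Λ ξ
  rw [← rcCondLaw_real_eq_of_wiring hp hq hξ hR hAm hA, ofReal_measureReal]

end Kernel

end Summit.CriticalPhenomena.PercolationContinuityZ3.Theorems.FK

end
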